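import Summits.CriticalPhenomena.PercolationContinuityZ3.Theorems.FK.BoxClusterCountFreeLimit
import Summits.CriticalPhenomena.PercolationContinuityZ3.Theorems.FK.BoxClusterCountWiredLimit
import Summits.CriticalPhenomena.PercolationContinuityZ3.Theorems.FK.BoundaryWiringSandwich
import HarnessLib

/-!
# FK-continuity cell, FO-10a: the number of open clusters per site under an ARBITRARY one-class boundary wiring
# `B_N ⊆ ∂Λ_N` — `κ¹ ≤ liminf ≤ limsup ≤ κ⁰` (Grimmett 2006, (4.80)–(4.82)), the limit `κ` at points of uniqueness
# ((4.84)), and UNIQUENESS `φ⁰_{p,q} = φ¹_{p,q}` IFF THE CLUSTER DENSITY IS INSENSITIVE TO THE BOUNDARY WIRING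

Registered R109 (cell INBOX l.7500, 2026-08-25); registry row FO-10a-g341; label CCL-D (coordinator fk-4 g227).
Cell `fk-continuity` (bschramm), row FO-10a (domain-Markov + boundary-condition comparison layer over FO-06); support file
for the FK-continuity transplant (`--supports stmt-CriticalPhenomena-4575`); builds on p205010 (kernel theorem, internal
audit signed; external expert review pending). Pure proofs; no definitions, no named facts, no sorries; `d ≥ 1`.
UNCONDITIONAL finite- and infinite-volume structure; it decides nothing about FH / TP_FK / the value of `p_c(q)`.

Grimmett's proof of Lemma (4.79) compares the `κ`-derivative `|E_Λ|⁻¹ φ^ξ_{Λ,p,q}(k(ω,Λ))` of the finite-volume pressure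
with any boundary condition `ξ` to the free and wired ones ((4.80)–(4.82)) and identifies the limits `d⁻¹ φ^b_{p,q}(|C_0|⁻¹)`
((4.83)–(4.84)). With the two-sided limits of the companion files (`BoxClusterCountFreeLimit`, `BoxClusterCountWiredLimit`:
`|Λ_N|⁻¹ E^b_{Λ_N}[k^b] → κ^b(p,q) = ∫ |C_0|⁻¹ dφ^b_{p,q}`, no ergodic theorem) this file treats the box measures
`φ^B_{Λ_N,p,q} = rcMeasure (finsetGraph (zdGraph d) (box d N)) p q B` with an arbitrary wired class `B ⊆ ∂Λ_N` and their
OWN cluster count `k^B` (the clusters meeting `B` count as one), for `0 ≤ p ≤ 1`, `q ≥ 1`, `d ≥ 1`: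

* §1 finite volume: `k^{B'} ≤ k^B` for `B ⊆ B'` (`clusterCount_anti_wired`, over the Literature's `wired_mono`);
  `E^B_{Λ_N}[k^B] ≤ E⁰_{Λ_N}[k]` for every `B` (`rcExpect_clusterCount_le_false`: `k^B ≤ k = Σ_x |C_x|⁻¹` is a nonnegative
  combination of the constant and the decreasing events `{|C_x| < k}`, on which `φ^B_{Λ_N} ≤ φ⁰_{Λ_N}`, Lemma (4.14)(b));
  `Σ_x E¹_{Λ_N}[1{C_x ∩ ∂Λ_N = ∅}·|C_x|⁻¹] ≤ E^B_{Λ_N}[k^B]` for `B ⊆ ∂Λ_N` (`sum_rcExpect_ite_true_le_rcExpect_clusterCount`);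
* §2 limits along any sequence of wirings `B_N ⊆ ∂Λ_N`: **`κ¹(p,q) ≤ liminf_N |Λ_N|⁻¹ E^{B_N}_{Λ_N}[k^{B_N}]`**,
  **`limsup_N |Λ_N|⁻¹ E^{B_N}_{Λ_N}[k^{B_N}] ≤ κ⁰(p,q)`** (`le_liminf_rcExpect_clusterCount_div_card_box`,
  `limsup_rcExpect_clusterCount_div_card_box_le`); hence the limit `κ⁰(p,q)` whenever `κ⁰ = κ¹`, i.e. (Prop. (4.85),
  `ClusterDensityCriterion`) whenever `φ⁰_{p,q} = φ¹_{p,q}` (`tendsto_rcExpect_clusterCount_div_card_box_of_rcLimit_eq`);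
* §3 **uniqueness iff wiring-insensitivity of the cluster density**: `φ⁰_{p,q} = φ¹_{p,q}` iff along EVERY sequence of
  wirings `B_N ⊆ ∂Λ_N` the number of clusters per site converges to `κ⁰(p,q)`
  (**`rcLimit_false_eq_rcLimit_true_iff_forall_wiring_clusterCount`**; "only if" by §2, "if" by the wired sequence and
  Prop. (4.85)); at a point of non-uniqueness the free and wired counts per site have DIFFERENT limits `κ⁰ > κ¹`;
  per-edge normalisation `|E_{Λ_N}|⁻¹ E^b_{Λ_N}[k^b] → κ^b/d` (Grimmett's `dG^b_Λ/dκ`, (4.72) with (4.84));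
  the critical FK–Ising model on `ℤ^d`, `d ≥ 3`: `|Λ_N|⁻¹ E^{B_N}_{Λ_N, p_c(2), 2}[k^{B_N}] → κ(p_c(2),2)` whatever the wirings
  (ADS 2015 through `UniquenessCriticalFKIsing`).

Honest framing: infinite-volume bookkeeping for the boundary conditions expressible in the tree (ONE wired class); no
statement about `p_c(q)`; the `q = 2` clause is a COROLLARY of the in-tree ADS chain; NOT a binder discharge, NOT `_r4`.

## References

* G. Grimmett, *The Random-Cluster Model*, Springer 2006 (`book:grimmett2006-random-cluster-model`): Lemma (4.14)(b),
  §4.5 Thm. (4.58) with (4.72), Lemma (4.79), (4.80)–(4.84), Prop. (4.85) [PDF pp. 74, 86, 92–95]; Conj. (5.34)(ii). [Grimmett2006]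
* M. Aizenman, H. Duminil-Copin, V. Sidoravicius, Comm. Math. Phys. 334 (2015) 719–742, Thm. 1.2, Cor. 1.5(1).
  [AizenmanDuminilCopinSidoraviciusCMP2015]
-/

noncomputable section

open scoped Classical
open Finset Filter Topology MeasureTheory

namespace Summit.CriticalPhenomena.PercolationContinuityZ3.Theorems.FK

open Literature.Probability.Percolation Literature.Probability.LatticeModels
open Literature.Barriers.CriticalPhenomena

/-! ### §1 Finite volume: `k^{∂Λ} ≤ k^B ≤ k` and the comparison of their means -/

section Finite

/-- **Wiring more vertices lowers the number of clusters: `k^{B'}(ω) ≤ k^B(ω)` for `B ⊆ B'`.**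
[cite: Grimmett2006, §4.2 (4.12) and Lemma (4.14)(b)] -/
theorem clusterCount_anti_wired {V : Type*} [Finite V] (ω : BondConfig V) {B B' : Set V} (h : B ⊆ B') :
    clusterCount ω B' ≤ clusterCount ω B := by
  unfold clusterCount
  exact SimpleGraph.ConnectedComponent.card_le_card_of_le (sup_le_sup_left (wired_mono h) _)

/-- The number of clusters is at most the number of vertices. [folklore] -/
theorem clusterCount_le_card {V : Type*} [Fintype V] (ω : BondConfig V) (B : Set V) :
    clusterCount ω B ≤ Fintype.card V := by
  rw [clusterCount, ← Nat.card_eq_fintype_card]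
  exact Nat.card_le_card_of_surjective (fun v => (openGraph ω ⊔ wired B).connectedComponentMk v)
    (fun c => by induction c using SimpleGraph.ConnectedComponent.ind with | h v => exact ⟨v, rfl⟩)

variable {d : ℕ} {p q : ℝ}

/-- `0 ≤ |Λ_N|⁻¹ E^B_{Λ_N,p,q}[k^B] ≤ 1`. [folklore] -/
theorem rcExpect_clusterCount_div_card_box_mem_Icc (hp : p ∈ Set.Icc (0 : ℝ) 1) (hq : 0 < q) {N : ℕ}
    (B : Set ↥(box d N)) :
    rcExpect (finsetGraph (zdGraph d) (box d N)) p q B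
        (fun ω => (clusterCount (↑ω : BondConfig ↥(box d N)) B : ℝ)) / #(box d N) ∈ Set.Icc (0 : ℝ) 1 := by
  have hcardpos : (0 : ℝ) < #(box d N) := by exact_mod_cast Finset.card_pos.2 (box_nonempty d N)
  refine ⟨div_nonneg (rcExpect_nonneg _ hp hq _ fun ω _ => Nat.cast_nonneg _) hcardpos.le, ?_⟩
  rw [div_le_one hcardpos, ← rcExpect_const (finsetGraph (zdGraph d) (box d N)) hp hq B (#(box d N) : ℝ)]
  refine rcExpect_mono _ hp hq _ fun ω _ => ?_
  have h := clusterCount_le_card (↑ω : BondConfig ↥(box d N)) B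
  rw [Fintype.card_coe] at h
  exact_mod_cast h

/-- **`E^B_{Λ_N,p,q}[k^B] ≤ E⁰_{Λ_N,p,q}[k]` for every wired class `B`** (`0 ≤ p ≤ 1`, `q ≥ 1`): `k^B ≤ k = Σ_x |C_x|⁻¹`
pointwise, and `E^B[|C_x|⁻¹] = 1 − Σ_k φ^B(|C_x| ≥ k)/((k−1)k) ≤ 1 − Σ_k φ⁰(|C_x| ≥ k)/((k−1)k) = E⁰[|C_x|⁻¹]` by
`φ⁰_{Λ_N} ≤ φ^B_{Λ_N}` on the increasing events `{|C_x| ≥ k}`. [cite: Grimmett2006, Lemma (4.14)(b) with (4.81)] -/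
theorem rcExpect_clusterCount_le_false (hp : p ∈ Set.Icc (0 : ℝ) 1) (hq : 1 ≤ q) {N : ℕ} (B : Set ↥(box d N)) :
    rcExpect (finsetGraph (zdGraph d) (box d N)) p q B (fun ω => (clusterCount (↑ω : BondConfig ↥(box d N)) B : ℝ)) ≤
      rcExpect (finsetGraph (zdGraph d) (box d N)) p q (boxBC d false N)
        (fun ω => (clusterCount (↑ω : BondConfig ↥(box d N)) (boxBC d false N) : ℝ)) := by
  have hq0 : 0 < q := one_pos.trans_le hq
  have hfree : boxBC d false N = (∅ : Set ↥(box d N)) := rfl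
  -- `k^B ≤ k^∅ = Σ_x |C_x|⁻¹` under `φ^B`
  have h1 : rcExpect (finsetGraph (zdGraph d) (box d N)) p q B
        (fun ω => (clusterCount (↑ω : BondConfig ↥(box d N)) B : ℝ)) ≤
      rcExpect (finsetGraph (zdGraph d) (box d N)) p q B
        (fun ω => ∑ x : ↥(box d N), (((openCluster (↑ω : BondConfig ↥(box d N)) x).ncard : ℝ))⁻¹) := by
    refine rcExpect_mono _ hp hq0 _ fun ω _ => ?_
    rw [← clusterCount_empty_eq_sum_inv_ncard_openCluster]
    exact_mod_cast clusterCount_le_clusterCount_empty (↑ω : BondConfig ↥(box d N)) B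
  refine h1.trans ?_
  have hk : (fun ω : Finset (Sym2 ↥(box d N)) => (clusterCount (↑ω : BondConfig ↥(box d N)) (boxBC d false N) : ℝ)) =
      fun ω : Finset (Sym2 ↥(box d N)) =>
        ∑ x : ↥(box d N), (((openCluster (↑ω : BondConfig ↥(box d N)) x).ncard : ℝ))⁻¹ := by
    funext ω
    rw [hfree, clusterCount_empty_eq_sum_inv_ncard_openCluster]
  rw [hk, rcExpect_finset_sum, rcExpect_finset_sum]
  refine Finset.sum_le_sum fun x _ => ?_
  rw [rcExpect_inv_ncard_eq_one_sub_sum hp hq0 B x, rcExpect_inv_ncard_eq_one_sub_sum hp hq0 (boxBC d false N) x]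
  refine sub_le_sub_left (Finset.sum_le_sum fun k hk => ?_) 1
  have hk2 : (2 : ℝ) ≤ k := by exact_mod_cast (Finset.mem_Icc.1 hk).1
  refine div_le_div_of_nonneg_right ?_ (by nlinarith)
  exact rcBoxMeasure_false_real_le_rcMeasure_real hp hq B (isUpperSet_clusterSizeGe' x k)

/-- `φ¹_{Λ_N}(D) ≤ φ^B_{Λ_N}(D)` for `B ⊆ ∂Λ_N` and a decreasing event `D` of the box graph.
[cite: Grimmett2006, Lemma (4.14)(b)] -/
theorem rcBoxMeasure_true_real_le_rcMeasure_real_of_isLowerSet (hp : p ∈ Set.Icc (0 : ℝ) 1) (hq : 1 ≤ q) {N : ℕ}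
    {B : Set ↥(box d N)} (hB : B ⊆ boxBC d true N) {D : Set (BondConfig ↥(box d N))} (hD : IsLowerSet D) :
    (rcBoxMeasure d true p q N).real D ≤ (rcMeasure (finsetGraph (zdGraph d) (box d N)) p q B).real D := by
  rw [rcBoxMeasure_true]
  exact rcMeasure_real_anti_wired_of_isLowerSet _ hp hq hB hD

/-- `{C_x ∩ S = ∅}` is a decreasing event. [folklore] -/
theorem isLowerSet_setOf_disjoint_openCluster {V : Type*} (x : V) (S : Set V) :
    IsLowerSet {ω : BondConfig V | Disjoint (openCluster ω x) S} :=
  fun _ _ hle hω => Set.disjoint_of_subset_left (openCluster_mono hle x) hω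

/-- `{C_x ∩ S = ∅, |C_x| < k}` is a decreasing event. [folklore] -/
theorem isLowerSet_setOf_disjoint_openCluster_and_not_le {V : Type*} (x : V) (S : Set V) (k : ℕ) :
    IsLowerSet {ω : BondConfig V | Disjoint (openCluster ω x) S ∧ ¬ (k : ℕ∞) ≤ (openCluster ω x).encard} :=
  fun _ _ hle hω => ⟨Set.disjoint_of_subset_left (openCluster_mono hle x) hω.1,
    fun h => hω.2 (h.trans (Set.encard_le_encard (openCluster_mono hle x)))⟩

/-- **`E¹_{Λ_N,p,q}[1{C_x ∩ ∂Λ_N = ∅}·|C_x|⁻¹] ≤ E^B_{Λ_N,p,q}[1{C_x ∩ ∂Λ_N = ∅}·|C_x|⁻¹]` for `B ⊆ ∂Λ_N`**: the integrand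
is a nonnegative combination of indicators of decreasing events (`BoxClusterCountWired`), on which `φ¹_{Λ_N} ≤ φ^B_{Λ_N}`.
[cite: Grimmett2006, Lemma (4.14)(b) with (4.81)] -/
theorem rcExpect_ite_true_le_rcExpect_ite (hp : p ∈ Set.Icc (0 : ℝ) 1) (hq : 1 ≤ q) {N : ℕ} {B : Set ↥(box d N)}
    (hB : B ⊆ boxBC d true N) (x : ↥(box d N)) :
    rcExpect (finsetGraph (zdGraph d) (box d N)) p q (boxBC d true N)
        (fun ω => if Disjoint (openCluster (↑ω : BondConfig ↥(box d N)) x) (boxBC d true N)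
          then (((openCluster (↑ω : BondConfig ↥(box d N)) x).ncard : ℝ))⁻¹ else 0) ≤
      rcExpect (finsetGraph (zdGraph d) (box d N)) p q B
        (fun ω => if Disjoint (openCluster (↑ω : BondConfig ↥(box d N)) x) (boxBC d true N)
          then (((openCluster (↑ω : BondConfig ↥(box d N)) x).ncard : ℝ))⁻¹ else 0) := by
  have hq0 : 0 < q := one_pos.trans_le hq
  set M := Fintype.card ↥(box d N) with hM
  have hfun : (fun ω : Finset (Sym2 ↥(box d N)) =>
      if Disjoint (openCluster (↑ω : BondConfig ↥(box d N)) x) (boxBC d true N)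
        then (((openCluster (↑ω : BondConfig ↥(box d N)) x).ncard : ℝ))⁻¹ else 0) =
      fun ω : Finset (Sym2 ↥(box d N)) =>
        (1 / (M : ℝ)) * (if (↑ω : BondConfig ↥(box d N)) ∈
            {ω : BondConfig ↥(box d N) | Disjoint (openCluster ω x) (boxBC d true N)} then (1 : ℝ) else 0) +
        ∑ k ∈ Finset.Icc 2 M, (1 / (((k : ℝ) - 1) * k)) *
          (if (↑ω : BondConfig ↥(box d N)) ∈ {ω : BondConfig ↥(box d N) |
              Disjoint (openCluster ω x) (boxBC d true N) ∧ ¬ (k : ℕ∞) ≤ (openCluster ω x).encard}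
            then (1 : ℝ) else 0) := by
    funext ω
    rw [ite_inv_ncard_openCluster_eq_sum, ← hM]
    simp only [Set.mem_setOf_eq, mul_ite, mul_one, mul_zero]
  rw [hfun, rcExpect_add, rcExpect_add, rcExpect_const_mul, rcExpect_const_mul, rcExpect_finset_sum, rcExpect_finset_sum,
    ← rcMeasure_real_eq_rcExpect _ hp hq0, ← rcMeasure_real_eq_rcExpect _ hp hq0]
  refine add_le_add (mul_le_mul_of_nonneg_left ?_ (by positivity)) (Finset.sum_le_sum fun k hk => ?_)
  · exact rcBoxMeasure_true_real_le_rcMeasure_real_of_isLowerSet hp hq hB (isLowerSet_setOf_disjoint_openCluster x _)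
  · have hk2 : (2 : ℝ) ≤ k := by exact_mod_cast (Finset.mem_Icc.1 hk).1
    rw [rcExpect_const_mul, rcExpect_const_mul, ← rcMeasure_real_eq_rcExpect _ hp hq0,
      ← rcMeasure_real_eq_rcExpect _ hp hq0]
    refine mul_le_mul_of_nonneg_left ?_ (div_nonneg zero_le_one (by nlinarith))
    exact rcBoxMeasure_true_real_le_rcMeasure_real_of_isLowerSet hp hq hB
      (isLowerSet_setOf_disjoint_openCluster_and_not_le x _ k)

/-- **`Σ_x E¹_{Λ_N,p,q}[1{C_x ∩ ∂Λ_N = ∅}·|C_x|⁻¹] ≤ E^B_{Λ_N,p,q}[k^B]` for `B ⊆ ∂Λ_N`** (`0 ≤ p ≤ 1`, `q ≥ 1`):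
compare under `φ¹_{Λ_N} ≤ φ^B_{Λ_N}` on decreasing events, then `1{C_x ∩ ∂Λ_N = ∅} ≤ 1{C_x ∩ B = ∅}` and
`Σ_x 1{C_x ∩ B = ∅}·|C_x|⁻¹ ≤ k^B` (`BoxClusterCountWiredLimit`). [cite: Grimmett2006, Lemma (4.14)(b) with (4.81)] -/
theorem sum_rcExpect_ite_true_le_rcExpect_clusterCount (hp : p ∈ Set.Icc (0 : ℝ) 1) (hq : 1 ≤ q) {N : ℕ}
    {B : Set ↥(box d N)} (hB : B ⊆ boxBC d true N) :
    ∑ x : ↥(box d N), rcExpect (finsetGraph (zdGraph d) (box d N)) p q (boxBC d true N)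
        (fun ω => if Disjoint (openCluster (↑ω : BondConfig ↥(box d N)) x) (boxBC d true N)
          then (((openCluster (↑ω : BondConfig ↥(box d N)) x).ncard : ℝ))⁻¹ else 0) ≤
      rcExpect (finsetGraph (zdGraph d) (box d N)) p q B (fun ω => (clusterCount (↑ω : BondConfig ↥(box d N)) B : ℝ)) := by
  have hq0 : 0 < q := one_pos.trans_le hq
  refine (Finset.sum_le_sum fun x _ => rcExpect_ite_true_le_rcExpect_ite hp hq hB x).trans ?_
  refine le_trans (Finset.sum_le_sum fun x _ => ?_) (sum_rcExpect_ite_inv_ncard_le_rcExpect_clusterCount _ hp hq0 B)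
  refine rcExpect_mono _ hp hq0 _ fun ω _ => ?_
  split_ifs with h1 h2
  · exact le_rfl
  · exact absurd (h1.mono_right hB) h2
  · positivity
  · exact le_rfl

end Finite

/-! ### §2 Limits along an arbitrary sequence of boundary wirings `B_N ⊆ ∂Λ_N` -/

section Limit

variable {d : ℕ} {p q : ℝ}

/-- **`limsup_N |Λ_N|⁻¹ E^{B_N}_{Λ_N,p,q}[k^{B_N}] ≤ κ⁰(p,q)`** for EVERY sequence of wired classes `B_N` (`d ≥ 1`, `0 ≤ p ≤ 1`,
`q ≥ 1`; `κ⁰(p,q) = ∫ |C_0|⁻¹ dφ⁰_{p,q}`). [cite: Grimmett2006, proof of Lemma (4.79), (4.80)–(4.84)] -/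
theorem limsup_rcExpect_clusterCount_div_card_box_le (hd : 0 < d) (hp : p ∈ Set.Icc (0 : ℝ) 1) (hq : 1 ≤ q)
    (B : ∀ N : ℕ, Set ↥(box d N)) :
    limsup (fun N => rcExpect (finsetGraph (zdGraph d) (box d N)) p q (B N)
        (fun ω => (clusterCount (↑ω : BondConfig ↥(box d N)) (B N) : ℝ)) / #(box d N)) atTop ≤
      ∫ ω, ((openCluster ω (0 : Site d)).ncard : ℝ)⁻¹ ∂(rcLimit d false p q) := by
  have hq0 : 0 < q := one_pos.trans_le hq
  rw [← (tendsto_rcExpect_clusterCount_div_card_box_false hd hp hq).limsup_eq]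
  refine limsup_le_limsup (Eventually.of_forall fun N => ?_) ?_ ?_
  · exact div_le_div_of_nonneg_right (rcExpect_clusterCount_le_false hp hq (B N)) (Nat.cast_nonneg _)
  · exact (isBoundedUnder_of ⟨(0 : ℝ), fun N => (rcExpect_clusterCount_div_card_box_mem_Icc hp hq0 (B N)).1⟩).isCoboundedUnder_le
  · exact isBoundedUnder_of ⟨(1 : ℝ), fun N => (rcExpect_clusterCount_div_card_box_mem_Icc hp hq0 (boxBC d false N)).2⟩

/-- **`κ¹(p,q) ≤ liminf_N |Λ_N|⁻¹ E^{B_N}_{Λ_N,p,q}[k^{B_N}]`** for every sequence of wired classes `B_N ⊆ ∂Λ_N` (`d ≥ 1`,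
`0 ≤ p ≤ 1`, `q ≥ 1`; `κ¹(p,q) = ∫ |C_0|⁻¹ dφ¹_{p,q}`). [cite: Grimmett2006, proof of Lemma (4.79), (4.80)–(4.84)] -/
theorem le_liminf_rcExpect_clusterCount_div_card_box (hd : 0 < d) (hp : p ∈ Set.Icc (0 : ℝ) 1) (hq : 1 ≤ q)
    {B : ∀ N : ℕ, Set ↥(box d N)} (hB : ∀ N, B N ⊆ boxBC d true N) :
    ∫ ω, ((openCluster ω (0 : Site d)).ncard : ℝ)⁻¹ ∂(rcLimit d true p q) ≤
      liminf (fun N => rcExpect (finsetGraph (zdGraph d) (box d N)) p q (B N)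
        (fun ω => (clusterCount (↑ω : BondConfig ↥(box d N)) (B N) : ℝ)) / #(box d N)) atTop := by
  have hq0 : 0 < q := one_pos.trans_le hq
  set κ₁ := ∫ ω, ((openCluster ω (0 : Site d)).ncard : ℝ)⁻¹ ∂(rcLimit d true p q) with hκ₁
  have hcob : IsCoboundedUnder (· ≥ ·) atTop (fun N => rcExpect (finsetGraph (zdGraph d) (box d N)) p q (B N)
      (fun ω => (clusterCount (↑ω : BondConfig ↥(box d N)) (B N) : ℝ)) / #(box d N)) :=
    (isBoundedUnder_of ⟨(1 : ℝ), fun N => (rcExpect_clusterCount_div_card_box_mem_Icc hp hq0 (B N)).2⟩).isCoboundedUnder_ge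
  -- for every `ε > 0`, eventually `κ₁ − ε ≤ |Λ_N|⁻¹ E^{B_N}[k^{B_N}]`
  refine le_of_forall_pos_le_add fun ε hε => ?_
  have h : κ₁ - ε ≤ liminf (fun N => rcExpect (finsetGraph (zdGraph d) (box d N)) p q (B N)
      (fun ω => (clusterCount (↑ω : BondConfig ↥(box d N)) (B N) : ℝ)) / #(box d N)) atTop := by
    refine le_liminf_of_le hcob ?_
    filter_upwards [eventually_le_sum_rcExpect_ite_inv_ncard_true_div hd hp hq hε] with N hN
    exact hN.trans (div_le_div_of_nonneg_right (sum_rcExpect_ite_true_le_rcExpect_clusterCount hp hq (hB N))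
      (Nat.cast_nonneg _))
  linarith

/-- **Grimmett's (4.80)–(4.84) for every boundary wiring: if `κ⁰(p,q) = κ¹(p,q)` then
`|Λ_N|⁻¹ E^{B_N}_{Λ_N,p,q}[k^{B_N}] → κ⁰(p,q)` along EVERY sequence of wired classes `B_N ⊆ ∂Λ_N`** (`d ≥ 1`, `0 ≤ p ≤ 1`,
`q ≥ 1`). [cite: Grimmett2006, proof of Lemma (4.79), (4.80)–(4.84)] -/
theorem tendsto_rcExpect_clusterCount_div_card_box_of_integral_eq (hd : 0 < d) (hp : p ∈ Set.Icc (0 : ℝ) 1)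
    (hq : 1 ≤ q) {B : ∀ N : ℕ, Set ↥(box d N)} (hB : ∀ N, B N ⊆ boxBC d true N)
    (h : ∫ ω, ((openCluster ω (0 : Site d)).ncard : ℝ)⁻¹ ∂(rcLimit d false p q) =
      ∫ ω, ((openCluster ω (0 : Site d)).ncard : ℝ)⁻¹ ∂(rcLimit d true p q)) :
    Tendsto (fun N => rcExpect (finsetGraph (zdGraph d) (box d N)) p q (B N)
        (fun ω => (clusterCount (↑ω : BondConfig ↥(box d N)) (B N) : ℝ)) / #(box d N)) atTop
      (𝓝 (∫ ω, ((openCluster ω (0 : Site d)).ncard : ℝ)⁻¹ ∂(rcLimit d false p q))) := by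
  have hq0 : 0 < q := one_pos.trans_le hq
  refine tendsto_of_le_liminf_of_limsup_le ?_ (limsup_rcExpect_clusterCount_div_card_box_le hd hp hq B) ?_ ?_
  · rw [h]
    exact le_liminf_rcExpect_clusterCount_div_card_box hd hp hq hB
  · exact isBoundedUnder_of ⟨(1 : ℝ), fun N => (rcExpect_clusterCount_div_card_box_mem_Icc hp hq0 (B N)).2⟩
  · exact isBoundedUnder_of ⟨(0 : ℝ), fun N => (rcExpect_clusterCount_div_card_box_mem_Icc hp hq0 (B N)).1⟩

/-- **Under uniqueness `φ⁰_{p,q} = φ¹_{p,q}` the number of clusters per site forgets the boundary wiring:**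
`|Λ_N|⁻¹ E^{B_N}_{Λ_N,p,q}[k^{B_N}] → κ⁰(p,q)` along every `B_N ⊆ ∂Λ_N`. [cite: Grimmett2006, Lemma (4.79) with (4.80)–(4.84)] -/
theorem tendsto_rcExpect_clusterCount_div_card_box_of_rcLimit_eq (hd : 0 < d) (hp : p ∈ Set.Icc (0 : ℝ) 1)
    (hq : 1 ≤ q) {B : ∀ N : ℕ, Set ↥(box d N)} (hB : ∀ N, B N ⊆ boxBC d true N)
    (huniq : rcLimit d false p q = rcLimit d true p q) :
    Tendsto (fun N => rcExpect (finsetGraph (zdGraph d) (box d N)) p q (B N)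
        (fun ω => (clusterCount (↑ω : BondConfig ↥(box d N)) (B N) : ℝ)) / #(box d N)) atTop
      (𝓝 (∫ ω, ((openCluster ω (0 : Site d)).ncard : ℝ)⁻¹ ∂(rcLimit d false p q))) :=
  tendsto_rcExpect_clusterCount_div_card_box_of_integral_eq hd hp hq hB
    ((rcLimit_false_eq_rcLimit_true_iff_integral_inv_ncard_eq hp hq 0).1 huniq)

end Limit

/-! ### §3 Uniqueness iff wiring-insensitivity of the cluster density; normalisations; the critical FK–Ising model -/

section Uniqueness

variable {d : ℕ} {p q : ℝ}

/-- **Uniqueness iff the number of clusters per site is insensitive to the boundary wiring**: for `d ≥ 1`,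
`0 ≤ p ≤ 1`, `q ≥ 1`, `φ⁰_{p,q} = φ¹_{p,q}` iff along EVERY sequence of wired classes `B_N ⊆ ∂Λ_N` the mean number of
open clusters per site of `φ^{B_N}_{Λ_N,p,q}` converges to `κ⁰(p,q)` ("if": the wired sequence gives `κ¹ = κ⁰`,
Prop. (4.85)). [cite: Grimmett2006, Lemma (4.79), (4.80)–(4.84), Prop. (4.85)] -/
theorem rcLimit_false_eq_rcLimit_true_iff_forall_wiring_clusterCount (hd : 0 < d) (hp : p ∈ Set.Icc (0 : ℝ) 1)
    (hq : 1 ≤ q) :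
    rcLimit d false p q = rcLimit d true p q ↔
      ∀ B : ∀ N : ℕ, Set ↥(box d N), (∀ N, B N ⊆ boxBC d true N) →
        Tendsto (fun N => rcExpect (finsetGraph (zdGraph d) (box d N)) p q (B N)
          (fun ω => (clusterCount (↑ω : BondConfig ↥(box d N)) (B N) : ℝ)) / #(box d N)) atTop
          (𝓝 (∫ ω, ((openCluster ω (0 : Site d)).ncard : ℝ)⁻¹ ∂(rcLimit d false p q))) := by
  refine ⟨fun h B hB => tendsto_rcExpect_clusterCount_div_card_box_of_rcLimit_eq hd hp hq hB h, fun h => ?_⟩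
  have h₁ := h (fun N => boxBC d true N) fun N => subset_rfl
  have hκ := tendsto_nhds_unique h₁ (tendsto_rcExpect_clusterCount_div_card_box_true hd hp hq)
  exact (rcLimit_false_eq_rcLimit_true_iff_integral_inv_ncard_eq hp hq 0).2 hκ

/-- **At a point of non-uniqueness the free and wired numbers of clusters per site have different limits**,
`lim |Λ_N|⁻¹ E¹_{Λ_N}[k¹] = κ¹ < κ⁰ = lim |Λ_N|⁻¹ E⁰_{Λ_N}[k]`. [cite: Grimmett2006, Lemma (4.79), (4.84), Prop. (4.85)] -/
theorem lim_clusterCount_true_lt_false_of_rcLimit_ne (hp : p ∈ Set.Icc (0 : ℝ) 1) (hq : 1 ≤ q)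
    (hne : rcLimit d false p q ≠ rcLimit d true p q) :
    ∫ ω, ((openCluster ω (0 : Site d)).ncard : ℝ)⁻¹ ∂(rcLimit d true p q) <
      ∫ ω, ((openCluster ω (0 : Site d)).ncard : ℝ)⁻¹ ∂(rcLimit d false p q) :=
  integral_inv_ncard_lt_of_rcLimit_false_ne_rcLimit_true hp hq hne 0

/-- **Per-edge normalisation (Grimmett's `dG^b_Λ/dκ`, (4.72) with (4.84)): `|E_{Λ_N}|⁻¹ E^b_{Λ_N,p,q}[k^b] → κ^b(p,q)/d`**
for `b ∈ {0, 1}` (`d ≥ 1`, `0 ≤ p ≤ 1`, `q ≥ 1`). [cite: Grimmett2006, Thm. (3.73)(a), (4.72), (4.84)] -/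
theorem tendsto_rcExpect_clusterCount_div_card_edgesIn (hd : 0 < d) (hp : p ∈ Set.Icc (0 : ℝ) 1) (hq : 1 ≤ q)
    (b : Bool) :
    Tendsto (fun N => rcExpect (finsetGraph (zdGraph d) (box d N)) p q (boxBC d b N)
        (fun ω => (clusterCount (↑ω : BondConfig ↥(box d N)) (boxBC d b N) : ℝ)) / #(edgesIn (zdGraph d) (box d N)))
      atTop (𝓝 ((∫ ω, ((openCluster ω (0 : Site d)).ncard : ℝ)⁻¹ ∂(rcLimit d b p q)) / d)) := by
  have hsite : Tendsto (fun N => rcExpect (finsetGraph (zdGraph d) (box d N)) p q (boxBC d b N)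
      (fun ω => (clusterCount (↑ω : BondConfig ↥(box d N)) (boxBC d b N) : ℝ)) / #(box d N)) atTop
      (𝓝 (∫ ω, ((openCluster ω (0 : Site d)).ncard : ℝ)⁻¹ ∂(rcLimit d b p q))) := by
    cases b
    · exact tendsto_rcExpect_clusterCount_div_card_box_false hd hp hq
    · exact tendsto_rcExpect_clusterCount_div_card_box_true hd hp hq
  have hedge := tendsto_card_edgesIn_box_div_card_box (d := d)
  have hd0 : (d : ℝ) ≠ 0 := by exact_mod_cast hd.ne'
  refine (hsite.div hedge hd0).congr' (Eventually.of_forall fun N => ?_)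
  have hcard : (#(box d N) : ℝ) ≠ 0 := by exact_mod_cast (Finset.card_pos.2 (box_nonempty d N)).ne'
  simp only [Pi.div_apply]
  rw [div_div_div_cancel_right₀ hcard]

/-- **The critical FK–Ising model on `ℤ^d`, `d ≥ 3`: the mean number of FK clusters per site of the critical finite-volume
measures converges to `κ(p_c(2), 2)` WHATEVER the boundary wirings `B_N ⊆ ∂Λ_N`** (uniqueness at `p_c(2)`,
`UniquenessCriticalFKIsing`, from ADS 2015). [cite: Grimmett2006, Lemma (4.79) with (4.80)–(4.84); Conj. (5.34)(ii) at q = 2]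
[cite: AizenmanDuminilCopinSidoraviciusCMP2015, Thm. 1.2 with Cor. 1.5 (1)] -/
theorem tendsto_rcExpect_clusterCount_div_card_box_rcCriticalProb_two (hd : 3 ≤ d) {B : ∀ N : ℕ, Set ↥(box d N)}
    (hB : ∀ N, B N ⊆ boxBC d true N) :
    Tendsto (fun N => rcExpect (finsetGraph (zdGraph d) (box d N)) (rcCriticalProb d 2) 2 (B N)
        (fun ω => (clusterCount (↑ω : BondConfig ↥(box d N)) (B N) : ℝ)) / #(box d N)) atTop
      (𝓝 (∫ ω, ((openCluster ω (0 : Site d)).ncard : ℝ)⁻¹ ∂(rcLimit d false (rcCriticalProb d 2) 2))) :=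
  tendsto_rcExpect_clusterCount_div_card_box_of_rcLimit_eq (by omega) (rcCriticalProb_mem_Icc d 2) (by norm_num) hB
    (rcLimit_false_eq_rcLimit_true_rcCriticalProb_two hd)

end Uniqueness

end Summit.CriticalPhenomena.PercolationContinuityZ3.Theorems.FK

end
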